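import Literature.MathematicalPhysics.QuantumFieldTheory.Balaban1983to89.T4SeparableFibreExpansion

/-!
# `Balaban1983to89.T4AvgDiagBound` — the ONE-BOND SYMMETRIC SECOND-DIFFERENCE (diagonal) RATE of loop variables of
# iterated averages: the hypothesis shape `LoopDiagDerivBound av dom C₃ θ₃` in `T4AvgDerivBound`'s vocabulary, and its
# junction BY NAME with `T4SeparableFibreExpansion` §5 — the EVEN part of the (CM) channel's one-bond increments and the
# `θ`-small FLOOR `κ` of the increment reading's suppression datum, for one loop weight and for the named product weights
# `loopProdW`, plus (§4, v1.1) the rate arithmetic of that floor (cell T4, node O3.E-i′ (β) / uniqueness-spine channel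
# (CM); typing seam; answers the located item (L-e) of GAPS G-pv16g13-3; unit `b2b-balaban-t4-lean` gen 17 (v1) / gen 18
# (v1.1), journal rows T4-T.L-AVGDIAG* / T4-T.L-AVGDIAG-v1.1*; ADDITIVE LEAF — no existing module is modified; one
# importer at v1.1 time, `T4AdaptedReference` (pv16 lineage), whose consumed names are untouched)

HONEST FRAMING.  Audit cell `pub-balaban`; this file belongs to the (CM)-channel bookkeeping of rung (B)+1 = the `ε → 0`
limit of expectations of unit-scale averaged gauge-invariant loop variables on ONE four-torus of fixed physical size,
under (B) = [Balaban1989LargeFieldII] Thm 1 and a β-function hypothesis carried as antecedents of the cell's targets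
(`T4Continuum` / `T4Apex*`); NOT infinite volume, NOT a mass gap, NOT the Clay problem, and nothing here is progress on
any of them.  STATEMENTS AND ELEMENTARY ALGEBRA ONLY: the one hypothesis SHAPE defined below is the cell's typing of an
estimate that is NOT PRINTED for Bałaban's averaging operations; it is consumed only as a hypothesis and NEVER asserted
of any datum; no estimate for Bałaban's scheme is proved.  Kernel content = the algebra of symmetric second differences
of products (§0) and instantiation of theorems already in the tree (§2–§3), all [folklore], sorry-free.

WHY THIS FILE (the located request, verbatim from the cell journal, `b2b-balaban-pv16-g13` CORRECTION l.51626 = GAPS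
G-pv16g13-3): the (CM) channel's law-side datum for the INCREMENT reading `g(V₀←y) − g(V₀←y₀)` of a loop weight has a
floor `κ` coming from the EVEN (reflection-symmetric) part of each one-bond increment — "its size is SECOND order in the
one-bond change (needs a one-bond second-derivative modulus of the averaged loop weight, θ₁²-type, NOT first order)" —
and first-order data (`T4AvgDerivBound.LoopDerivBound`) bound it only by a quantity of the increments' own order, while
the pair shape `LoopPairDerivBound` (two DISTINCT bonds) says nothing on the diagonal.  `T4SeparableFibreExpansion` §5
isolated the exact algebraic slot: `abs_evenIncr_le_of_secondDiff` takes a bound `c` on the SYMMETRIC SECOND DIFFERENCE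
`g(y₀; b←y_b) − 2g(y₀) + g(y₀; b←y₀_b·y_b⁻¹·y₀_b)` and returns `|evenIncr| ≤ c/2`.  This leaf TYPES the averaging-side
shape that fills the slot with `c = C₃·|w|·bdist(y₀ b, y b)²·θ₃ⁿ` and carries it BY NAME to the floor
`κ u = (rate/2)·M u`, `M u` = a one-bond second-moment bound of the conditional law at the exterior `u` (a binder).

CITATION HEADER (lean-in-tree rule 2026-08-18).  Typed skeleton around T. Bałaban, *Averaging operations for lattice
gauge theories*, Commun. Math. Phys. **98** (1985) 17–51 [Balaban1985Averaging] (cell paper B7; PDF page = journal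
page − 16).  WHAT IS PRINTED, of the KIND typed here (second-order behaviour of the COMPOSED `k`-step averaging function in
the fine field), verbatim, read by this seat on the renders `b2b-balaban-ref1/pages/1985-cmp98-averaging/1985-cmp98-
averaging-p022-x2.png`, `…-p026-x2.png`, `…-p027-x2.png`:
* p. 38 [PDF 22], Proposition 4: "There exist constants C₂, c₄ such that for α₀, α₁ ≤ c₄ the function
  Q_k(U₀, ηA, c) = (1/i) log(Ū₁ᵏ)_c, c ⊂ Ω^{(k)}, is an analytic function of the variables A_b, b ⊂ B^k(c₋)∪B^k(c₊).
  Further we have Q_k(U₀, ηA) = Q_k(U₀)A + C_k(U₀, A), (134) and |C_k(U₀, A)| ≤ C₂|A|² < C₂α₁². (135)"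
  (glosses, v1.1 — p. 37 [PDF 21], verbatim: "We assume that U₀ satisfies the assumptions of Proposition 2 and
  U₁ = e^{iηA}, |A| < α₁." — so `U₁ = e^{iηA}` is the fine small-field variable [v1 of this header glossed
  «U₁ = e^{iηA}U₀, p. 37», which is NOT what p. 37 prints: DOCFIX v1.1, XREAD ref5 #164 item D1 = REFEREE-2 pass 14
  G-t4r2-23];
  `Q_k(U₀)` is the composition of the linear parts of Prop. 3, p. 38: "Q_{j+1}(U₀) = Q(Ū₀ʲ)Q_j(U₀)"; and — a READING by
  this seat, NOT a printed statement — the `j = k` bound (133), p. 38: "|Q_k(U₀, ηA) − Q_k(U₀)A| < e^{O(1)(1+L⁻²+…+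
  L^{−2(k−1)})α₀}·4C₁(1 + L⁻¹ + … + L^{−(k−1)})α₁² < e^{O(1)2α₀}8C₁α₁² = C₂α₁²." is the inductive bound (130) at `j = k`
  written WITHOUT the prefactor `1/(Lʲη)` that (130)–(132) carry, i.e. in the normalisation `Lᵏη = 1` (the `k`-th coarse
  lattice is the unit lattice) [v1 wrote «by (133) the k-th coarse lattice is the unit lattice, L^kη = 1» — a
  mis-locator: (133) prints the bound, not the normalisation: DOCFIX v1.1, item D2 = G-t4r2-23]).
* p. 42 [PDF 26], Proposition 5, (157): "|δ/δA_b C_k(U₀, A, c)| ≤ C₃|A| < C₃α₁."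
* p. 43 [PDF 27], Proposition 7: "For U₀ satisfying (52) and U′ = e^{iηA′}, |A′| < α₁, α₀, α₁ sufficiently small, the
  function Q_k(U′U₀, ηA) is analytic in complex variables A′, A, and Proposition 4 holds uniformly in A′."
WHAT THESE DO AND DO NOT GIVE [analysis, this seat; NOT a printed statement]: (134)–(135) IS a second-order Taylor
remainder bound for the composed averaging function — in the SUP NORM `|A| = sup_b |A_b|` of the fine perturbation.  Read
for a perturbation supported on ONE fine bond `b` of angle `a_b = ηA_b` (the tree's `bdist`), (135) gives
`|C_k| ≤ C₂η^{−2}|a_b|² = C₂L^{2k}·bdist²`: bounded on the domain (`bdist < ηα₁`) but with NO decay in the number of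
steps — a sup-norm remainder cannot localise.  The ONE-BOND form WITH A RATE `θ₃ < 1` per step, for the LOOP VARIABLE of
the average — the shape `LoopDiagDerivBound` below — is therefore NOT PRINTED; its expected origin (item (L-a) of GAPS
G-pv16g13-2 and G-pv16g13-3: a one-step bilinear sensitivity bound plus a second-order tower chain rule modulo gauge,
companion of `T4AvgDerivBound.loopVarBound_of_stepContraction`) is LOCATED, OPEN, and NOT attempted here.  WHICH RATE
TO EXPECT [analysis, this seat; CORRECTED at v1.1]: v1 of this header wrote «giving `θ₃ ≍ θ₁²`» after the sanity model
(abelian `G`, LINEAR averaging `C_k ≡ 0`: the loop variable `cos F` of a linear functional `F` with one-bond coefficient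
`≍ θ₁ⁿ` has symmetric second differences `≤ (θ₁ⁿ·a_b)²`).  That model is the curvature-free corner: along a tower of
one-step maps `T` (`T 0 = 0`, rate `θ₁ = T′(0)`, one-step curvature `T₂ = T″(0)`) the second derivative of `W ∘ T^[n]` at
the reference is `W″(0)·(θ₁ⁿ)² + W′(0)·Sₙ` with `T₂θ₁ⁿ ≤ Sₙ₊₁ ≤ T₂θ₁ⁿ/(1 − θ₁)` — second order along the tower decays at
the FIRST-order rate, with an `n`-independent coefficient, unless `T₂ = 0`.  So the generic expectation for an instance
of the shape is `θ₃ = θ₁` (`θ₁²` only for curvature-free one-step maps), consistent with (135)/(157) carrying no decay in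
`k`.  KERNEL TOY for this, cited BY NAME (not imported; scalar tower maps — NOT a statement about Bałaban's averagings):
`T4JetTower.TowerMap.S_succ_eq`, `TowerMap.S_succ_lower`, `TowerMap.S_succ_upper`, `TowerMap.hasDerivAt_obs_iterate`,
`TowerMap.exists_sq_rate_lt_obs`, `TowerMap.obs_second_eq_of_T₂`, `T4JetTower.quadratic_not_sq_rate` (t4-ne1p-p3 lineage,
`T4JetTower.lean` v1 p188559).  NOTHING in the kernel content depends on the expectation: the shape keeps `θ₃` a FREE
parameter, §1–§3 hold for every `0 ≤ θ₃`, and §4 (v1.1) records that the diagonal floor's governing ratio in `n` is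
`max θ₃ θ₁²` and that `θ₃ = θ₁ < 1` already gives a summable floor.  The reflection triple of the shape is
[Balaban1985Averaging]'s `A′ ↦ −A′` in the coordinates `U′U₀`, `U′ = e^{iηA′}` of Prop. 6–7 (group form:
`V_b ↦ V_b·(V′_b)⁻¹·V_b`, `T4SeparableFibreExpansion.bondReflect`).  NOT used: any other statement of the paper; the
manuscript series under audit is not cited for any disputed step; no programme-internal claim is cited.

CONTENTS (all [folklore]; tags in docstrings).
§0 `diag_mul`, `abs_prod_map_le_one`, `abs_prod_sub_prod_le`, `abs_diag_prod_le` — symmetric second differences of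
   products of reals bounded by one: `|∏f − 2∏f₀ + ∏f₋| ≤ Σ Δᵢ + (Σ δᵢ)²` from one-sided first-difference majorants `δᵢ`
   and diagonal second-difference majorants `Δᵢ` (list induction on the product rule).
§1 `LoopDiagDerivBound av dom C₃ θ₃` (the shape; field form over reflection triples `V, V₊, V₋` agreeing off one bond,
   no decidability needed), `.mono`, `.anti`, `.swap`; `bdist_reflect`, `reflect_reflect`.
§2 ONE LOOP WEIGHT `g = W_{(x,w)} ∘ iterFrom av k n`: `abs_secondDiff_loop_le` (the shape along a fibre `V₀ ← y` IS the
   `hdiag` of `abs_evenIncr_le_of_secondDiff`), `abs_evenIncr_loop_le` (`|evenIncr| ≤ C₃|w|bdist²θ₃ⁿ/2`),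
   `abs_condMean_evenReading_loop_le` / `heven_loop` (the floor: `|E^{wt}[evenReading | u]_b| ≤ (C₃|w|θ₃ⁿ/2)·M u` from a
   one-bond second-moment bound `∫ bdist(y₀ b, y b)² d(condLaw s wt u) ≤ M u` — via `abs_condMean_evenReading_le`),
   `condMeanSuppression_incrReading_loop` (plugged into `condMeanSuppression_incrReading_of_split`: the increment
   reading's datum `CondMeanSuppression domU (E^{wt}[incrReading|·]) univ (lip·dev + (C₃|w|θ₃ⁿ/2)·M) 1`).
§3 THE NAMED PRODUCT WEIGHTS `loopProdW av k n ws`: `loopProdDiagRate C₁ θ₁ C₃ θ₃ n ws = Σᵢ C₃|wᵢ|θ₃ⁿ + (Σᵢ C₁|wᵢ|θ₁ⁿ)²`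
   (companion of `loopProdRate`), `abs_secondDiff_loopProdW_le` (from `LoopDerivBound ∧ LoopDiagDerivBound`, factors
   bounded by one, reflected side of equal size `bdist_bondReflect`), `abs_evenIncr_loopProdW_le`, `heven_loopProdW`,
   `condMeanSuppression_incrReading_loopProdW`.
§4 (v1.1) RATE ARITHMETIC of the floor: `totalWordLen` (+ `_nil`, `_cons`, `_nonneg`, `sum_map_mul_length_mul`),
   `loopProdDiagRate_eq` (closed form `C₃ℓθ₃ⁿ + (C₁ℓ)²(θ₁²)ⁿ`), `loopProdDiagRate_mono_theta`, `loopProdDiagRate_le_geom`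
   (governing ratio `max θ₃ θ₁²`), `tendsto_loopProdDiagRate`, `summable_loopProdDiagRate`, `tsum_loopProdDiagRate`
   (`= C₃ℓ/(1−θ₃) + (C₁ℓ)²/(1−θ₁²)`), `loopProdDiagRate_le_firstOrder` (at `θ₃ = θ₁`: first-order decay suffices).
VERSIONS.  v1 (gen 17, p188361 320a3369bf49).  v1.1 (gen 18): DOCFIX of the two header glosses on p. 37 / (133) (XREAD
`ref5` #164 items D1–D2 = REFEREE-2 pass 14 G-t4r2-23; renders p021/p022 re-read as images by this seat), the header's and
`LoopDiagDerivBound`'s [analysis] expectation «θ₃ ≍ θ₁²» CORRECTED to the generic first-order expectation `θ₃ = θ₁` after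
the kernel toy `T4JetTower` v1 (by name), and the ADDITIVE §4; every v1 declaration byte-identical.
WHAT IS NOT HERE: no instance of `LoopDiagDerivBound` for Bałaban's averagings (NOT PRINTED, not claimed); no second
moment bound `M` of Bałaban's conditional laws (a binder; obligation of the law side, record `t4/T4-EST-O3Ei1.md`); no
statement about densities, rates in `K`, or the (CM) channel's closure.  Hygiene: imports `T4SeparableFibreExpansion`
only (hence `T4AvgDerivBound`, `T4CondMeanChannelInsert` and their cones; `T4JetTower` is NOT imported); no `Summits/`
name; importer at v1.1 time: `T4AdaptedReference` (pv16).
-/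

namespace Literature.MathematicalPhysics.QuantumFieldTheory.Balaban1983to89.T4AvgDiagBound

open Literature.MathematicalPhysics.QuantumFieldTheory.Balaban1983to89

/-! ## §0 Symmetric (diagonal) second differences of products — algebra over `ℝ` -/

section Algebra

/-- THE PRODUCT RULE for symmetric second differences: with the three values `a, a₀, aₘ` of one factor and `b, b₀, bₘ`
of the other, `ab − 2a₀b₀ + aₘbₘ = (a − 2a₀ + aₘ)b₀ + a₀(b − 2b₀ + bₘ) + (a − a₀)(b − b₀) + (aₘ − a₀)(bₘ − b₀)`.
[folklore] -/
theorem diag_mul (a a₀ aₘ b b₀ bₘ : ℝ) :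
    a * b - 2 * (a₀ * b₀) + aₘ * bₘ
      = (a - 2 * a₀ + aₘ) * b₀ + a₀ * (b - 2 * b₀ + bₘ) + (a - a₀) * (b - b₀) + (aₘ - a₀) * (bₘ - b₀) := by
  ring

/-- A product of factors bounded by one is bounded by one. [folklore] -/
theorem abs_prod_map_le_one {ι : Type*} (f : ι → ℝ) :
    ∀ l : List ι, (∀ i ∈ l, |f i| ≤ 1) → |(l.map f).prod| ≤ 1
  | [], _ => by simp
  | i :: l, h => by
    have hi : |f i| ≤ 1 := h i List.mem_cons_self
    have hl : |(l.map f).prod| ≤ 1 := abs_prod_map_le_one f l fun i' hi' => h i' (List.mem_cons_of_mem i hi')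
    simpa only [List.map_cons, List.prod_cons, abs_mul] using mul_le_one₀ hi (abs_nonneg _) hl

/-- FIRST DIFFERENCES OF PRODUCTS of factors bounded by one: `|∏ fᵢ − ∏ gᵢ| ≤ Σ |fᵢ − gᵢ|`-type bound with given
majorants `δᵢ`. [folklore] -/
theorem abs_prod_sub_prod_le {ι : Type*} (f g δ : ι → ℝ) :
    ∀ l : List ι, (∀ i ∈ l, |f i| ≤ 1 ∧ |g i| ≤ 1 ∧ |f i - g i| ≤ δ i) →
      |(l.map f).prod - (l.map g).prod| ≤ (l.map δ).sum
  | [], _ => by simp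
  | i :: l, h => by
    obtain ⟨hf, hg, hd⟩ := h i List.mem_cons_self
    have hl : ∀ i' ∈ l, |f i'| ≤ 1 ∧ |g i'| ≤ 1 ∧ |f i' - g i'| ≤ δ i' :=
      fun i' hi' => h i' (List.mem_cons_of_mem i hi')
    have IH := abs_prod_sub_prod_le f g δ l hl
    have hF : |(l.map f).prod| ≤ 1 := abs_prod_map_le_one f l fun i' hi' => (hl i' hi').1
    have hδ : 0 ≤ δ i := (abs_nonneg _).trans hd
    simp only [List.map_cons, List.prod_cons, List.sum_cons]
    have e : f i * (l.map f).prod - g i * (l.map g).prod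
        = (f i - g i) * (l.map f).prod + g i * ((l.map f).prod - (l.map g).prod) := by ring
    rw [e]
    refine (abs_add_le _ _).trans (add_le_add ?_ ?_)
    · rw [abs_mul]
      simpa only [mul_one] using mul_le_mul hd hF (abs_nonneg _) hδ
    · rw [abs_mul]
      simpa only [one_mul] using mul_le_mul hg IH (abs_nonneg _) zero_le_one

/-- **SYMMETRIC SECOND DIFFERENCES OF PRODUCTS** of factors bounded by one: if every factor's three values are bounded
by one, its two one-sided first differences by `δᵢ` and its symmetric second difference by `Δᵢ`, then the product's
symmetric second difference is at most `Σ Δᵢ + (Σ δᵢ)²` (induction on `diag_mul`; the cross terms give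
`2 Σ_{i<j} δᵢδⱼ ≤ (Σ δᵢ)²`). [folklore] -/
theorem abs_diag_prod_le {ι : Type*} (f f₀ fₘ δ Δ : ι → ℝ) :
    ∀ l : List ι, (∀ i ∈ l, |f i| ≤ 1 ∧ |f₀ i| ≤ 1 ∧ |fₘ i| ≤ 1 ∧ |f i - f₀ i| ≤ δ i ∧ |fₘ i - f₀ i| ≤ δ i ∧
        |f i - 2 * f₀ i + fₘ i| ≤ Δ i) →
      |(l.map f).prod - 2 * (l.map f₀).prod + (l.map fₘ).prod| ≤ (l.map Δ).sum + (l.map δ).sum ^ 2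
  | [], _ => by simp; norm_num
  | i :: l, h => by
    obtain ⟨h₁, h₂, h₃, h₄, h₅, h₆⟩ := h i List.mem_cons_self
    have hl : ∀ i' ∈ l, |f i'| ≤ 1 ∧ |f₀ i'| ≤ 1 ∧ |fₘ i'| ≤ 1 ∧ |f i' - f₀ i'| ≤ δ i' ∧ |fₘ i' - f₀ i'| ≤ δ i' ∧
        |f i' - 2 * f₀ i' + fₘ i'| ≤ Δ i' := fun i' hi' => h i' (List.mem_cons_of_mem i hi')
    have IH := abs_diag_prod_le f f₀ fₘ δ Δ l hl
    have hP : |(l.map f).prod - (l.map f₀).prod| ≤ (l.map δ).sum :=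
      abs_prod_sub_prod_le f f₀ δ l fun i' hi' => ⟨(hl i' hi').1, (hl i' hi').2.1, (hl i' hi').2.2.2.1⟩
    have hM : |(l.map fₘ).prod - (l.map f₀).prod| ≤ (l.map δ).sum :=
      abs_prod_sub_prod_le fₘ f₀ δ l fun i' hi' => ⟨(hl i' hi').2.2.1, (hl i' hi').2.1, (hl i' hi').2.2.2.2.1⟩
    have hB₀ : |(l.map f₀).prod| ≤ 1 := abs_prod_map_le_one f₀ l fun i' hi' => (hl i' hi').2.1
    have hδ : 0 ≤ δ i := (abs_nonneg _).trans h₄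
    have hΔ : 0 ≤ Δ i := (abs_nonneg _).trans h₆
    have hS : 0 ≤ (l.map δ).sum := (abs_nonneg _).trans hP
    simp only [List.map_cons, List.prod_cons, List.sum_cons]
    rw [diag_mul]
    have t₁ : |(f i - 2 * f₀ i + fₘ i) * (l.map f₀).prod| ≤ Δ i := by
      rw [abs_mul]; simpa only [mul_one] using mul_le_mul h₆ hB₀ (abs_nonneg _) hΔ
    have t₂ : |f₀ i * ((l.map f).prod - 2 * (l.map f₀).prod + (l.map fₘ).prod)|
        ≤ (l.map Δ).sum + (l.map δ).sum ^ 2 := by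
      rw [abs_mul]; simpa only [one_mul] using mul_le_mul h₂ IH (abs_nonneg _) zero_le_one
    have t₃ : |(f i - f₀ i) * ((l.map f).prod - (l.map f₀).prod)| ≤ δ i * (l.map δ).sum := by
      rw [abs_mul]; exact mul_le_mul h₄ hP (abs_nonneg _) hδ
    have t₄ : |(fₘ i - f₀ i) * ((l.map fₘ).prod - (l.map f₀).prod)| ≤ δ i * (l.map δ).sum := by
      rw [abs_mul]; exact mul_le_mul h₅ hM (abs_nonneg _) hδ
    refine ((abs_add_le _ _).trans (add_le_add ((abs_add_le _ _).trans (add_le_add ((abs_add_le _ _).trans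
      (add_le_add t₁ t₂)) t₃)) t₄)).trans ?_
    nlinarith [sq_nonneg (δ i)]

end Algebra

/-! ## §1 The hypothesis shape: the ONE-BOND SYMMETRIC SECOND-DIFFERENCE RATE of loop variables of iterated averages -/

section Shape

open Literature.MathematicalPhysics.QuantumFieldTheory.Balaban1983to89.T4Continuum
open Literature.MathematicalPhysics.QuantumFieldTheory.Balaban1983to89.T4AvgSensitivity
open Literature.MathematicalPhysics.QuantumFieldTheory.Balaban1983to89.T4AvgDerivBound

variable {P : Params} {G : Type*} [GaugeGroup G]

/-- THE REFLECTED ONE-BOND CHANGE HAS THE SAME SIZE: `bdist g (g·h⁻¹·g) = bdist g h` (`dist1` is inversion invariant;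
field form of `T4SeparableFibreExpansion.bdist_bondReflect`). [folklore] -/
theorem bdist_reflect (g h : G) : bdist g (g * h⁻¹ * g) = bdist g h := by
  have e : g⁻¹ * (g * h⁻¹ * g) = (g⁻¹ * h)⁻¹ := by simp [mul_assoc]
  rw [bdist_def, bdist_def, e, GaugeGroup.dist1_inv]

/-- Reflecting twice returns: `g·(g·h⁻¹·g)⁻¹·g = h`. [folklore] -/
theorem reflect_reflect (g h : G) : g * (g * h⁻¹ * g)⁻¹ * g = h := by
  simp [mul_assoc]

/-- HYPOTHESIS SHAPE — THE ONE-BOND SYMMETRIC SECOND-DIFFERENCE RATE `LoopDiagDerivBound av dom C₃ θ₃` (cell typing of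
the located item (L-e)/(L-a) of GAPS G-pv16g13-3; NOT PRINTED; consumed only as a hypothesis): for every level `k`, every
number `n` of averaging steps with `k + n ≤ m + K`, every closed walk `(x, w)` at level `k + n`, every level-`k` bond `b`
and every REFLECTION TRIPLE of domain configurations — `V`; `Vₚ` = `V` changed at `b`; `Vₘ` = `V` changed at `b` to the
reflected value `V_b·(Vₚ)_b⁻¹·V_b` (in [Balaban1985Averaging]'s exponential coordinates `U′U₀`, `U′ = e^{iηA′}`, around the
reference this is `A′ ↦ −A′`) — the SYMMETRIC SECOND DIFFERENCE of the loop variable of the `n`-fold average is at most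
`C₃ · |w| · (size of the change at b)² · θ₃ⁿ`.  The printed statements of this KIND concern the composed averaging
FUNCTION in sup norm — [Balaban1985Averaging] Prop. 4 p. 38, (134) "Q_k(U₀, ηA) = Q_k(U₀)A + C_k(U₀, A)," (135)
"|C_k(U₀, A)| ≤ C₂|A|² < C₂α₁²." and Prop. 5 p. 42 (157) "|δ/δA_b C_k(U₀, A, c)| ≤ C₃|A| < C₃α₁." — a second-order
Taylor remainder in the SUP norm of the fine perturbation, which does NOT localise to one bond with a rate (read for a
one-bond perturbation it gives the constant `C₂η^{−2}` in group-distance units and no decay in `k`); the one-bond form with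
a rate `θ₃ < 1` is the cell's located estimate, NOT PRINTED and NOT proved here (which rate to expect [analysis]: v1
wrote «θ₃ ≍ θ₁²» after the abelian linearised model `C_k ≡ 0`, `W = cos F` — the curvature-free corner; the generic
expectation from the second-order tower chain rule is the FIRST-order rate `θ₃ = θ₁`, kernel toy
`T4JetTower.TowerMap.exists_sq_rate_lt_obs` / `obs_second_eq_of_T₂` cited by name in the header; `θ₃` is a free
parameter of the shape and §4 shows that `θ₃ = θ₁ < 1` still gives a summable floor).  `b07`'s pair shape
`LoopPairDerivBound` (two DISTINCT bonds) says nothing on this diagonal, and first-order data `LoopDerivBound` bound the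
symmetric second difference only by a quantity of the increments' own order (`2C₁|w|θ₁ⁿ·bdist`).
[cite: Balaban1985Averaging, Prop. 4 (134)-(135) p.38] -/
def LoopDiagDerivBound (av : ∀ j, Averaging P j G) (dom : ∀ j, Set (GaugeField P j G)) (C₃ θ₃ : ℝ) : Prop :=
  ∀ (k n : ℕ), k + n ≤ P.m + P.K → ∀ (x : Site P (k + n)) (w : List (Letter P.d)), walkEnd x w = x →
    ∀ (b : PBond P k) (V Vₚ Vₘ : GaugeField P k G), V ∈ dom k → Vₚ ∈ dom k → Vₘ ∈ dom k →
      (∀ c, c ≠ b → Vₚ c = V c) → (∀ c, c ≠ b → Vₘ c = V c) → Vₘ b = V b * (Vₚ b)⁻¹ * V b →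
        |loopAt (iterFrom av k n Vₚ) (walk x w) - 2 * loopAt (iterFrom av k n V) (walk x w)
            + loopAt (iterFrom av k n Vₘ) (walk x w)|
          ≤ C₃ * (w.length : ℝ) * bdist (V b) (Vₚ b) ^ 2 * θ₃ ^ n

/-- `LoopDiagDerivBound` is monotone in its constants (non-negative target constant). [folklore] -/
theorem LoopDiagDerivBound.mono {av : ∀ j, Averaging P j G} {dom : ∀ j, Set (GaugeField P j G)} {C C' θ θ' : ℝ}
    (h : LoopDiagDerivBound av dom C θ) (hC : C ≤ C') (hC' : 0 ≤ C') (hθ0 : 0 ≤ θ) (hθ : θ ≤ θ') :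
    LoopDiagDerivBound av dom C' θ' := by
  intro k n hn x w hw b V Vₚ Vₘ hV hVₚ hVₘ haₚ haₘ hb
  refine (h k n hn x w hw b V Vₚ Vₘ hV hVₚ hVₘ haₚ haₘ hb).trans ?_
  have hd : 0 ≤ bdist (V b) (Vₚ b) ^ 2 := sq_nonneg _
  have hw0 : (0 : ℝ) ≤ (w.length : ℝ) := Nat.cast_nonneg _
  have hpow : θ ^ n ≤ θ' ^ n := pow_le_pow_left₀ hθ0 hθ n
  have hpow0 : 0 ≤ θ ^ n := pow_nonneg hθ0 n
  calc C * (w.length : ℝ) * bdist (V b) (Vₚ b) ^ 2 * θ ^ n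
      ≤ C' * (w.length : ℝ) * bdist (V b) (Vₚ b) ^ 2 * θ ^ n := by gcongr
    _ ≤ C' * (w.length : ℝ) * bdist (V b) (Vₚ b) ^ 2 * θ' ^ n := by gcongr

/-- `LoopDiagDerivBound` is antitone in the domain. [folklore] -/
theorem LoopDiagDerivBound.anti {av : ∀ j, Averaging P j G} {dom dom' : ∀ j, Set (GaugeField P j G)} {C θ : ℝ}
    (h : LoopDiagDerivBound av dom C θ) (hdom : ∀ j, dom' j ⊆ dom j) : LoopDiagDerivBound av dom' C θ :=
  fun k n hn x w hw b V Vₚ Vₘ hV hVₚ hVₘ => h k n hn x w hw b V Vₚ Vₘ (hdom k hV) (hdom k hVₚ) (hdom k hVₘ)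

/-- THE SHAPE IS SYMMETRIC IN THE TRIPLE: the roles of `Vₚ` and `Vₘ` may be exchanged (each is the reflection of the
other through `V` at `b`, `reflect_reflect`; the sizes agree, `bdist_reflect`). [folklore] -/
theorem LoopDiagDerivBound.swap {av : ∀ j, Averaging P j G} {dom : ∀ j, Set (GaugeField P j G)} {C θ : ℝ}
    (h : LoopDiagDerivBound av dom C θ) {k n : ℕ} (hn : k + n ≤ P.m + P.K) {x : Site P (k + n)}
    {w : List (Letter P.d)} (hw : walkEnd x w = x) (b : PBond P k) {V Vₚ Vₘ : GaugeField P k G} (hV : V ∈ dom k)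
    (hVₚ : Vₚ ∈ dom k) (hVₘ : Vₘ ∈ dom k) (haₚ : ∀ c, c ≠ b → Vₚ c = V c) (haₘ : ∀ c, c ≠ b → Vₘ c = V c)
    (hb : Vₘ b = V b * (Vₚ b)⁻¹ * V b) :
    |loopAt (iterFrom av k n Vₘ) (walk x w) - 2 * loopAt (iterFrom av k n V) (walk x w)
        + loopAt (iterFrom av k n Vₚ) (walk x w)|
      ≤ C * (w.length : ℝ) * bdist (V b) (Vₘ b) ^ 2 * θ ^ n := by
  have hb' : Vₚ b = V b * (Vₘ b)⁻¹ * V b := by rw [hb, reflect_reflect]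
  have h' := h k n hn x w hw b V Vₚ Vₘ hV hVₚ hVₘ haₚ haₘ hb
  rw [hb, bdist_reflect]
  rwa [show loopAt (iterFrom av k n Vₘ) (walk x w) - 2 * loopAt (iterFrom av k n V) (walk x w)
      + loopAt (iterFrom av k n Vₚ) (walk x w) = loopAt (iterFrom av k n Vₚ) (walk x w)
      - 2 * loopAt (iterFrom av k n V) (walk x w) + loopAt (iterFrom av k n Vₘ) (walk x w) by ring]

end Shape

/-! ## §2 The junction with `T4SeparableFibreExpansion` §5 for ONE loop weight: the shape IS the `hdiag` of
`abs_evenIncr_le_of_secondDiff`, whence the even part and the FLOOR `κ` of the increment reading's suppression datum -/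

section Junction

open _root_.MeasureTheory
open Function (updateFinset)
open Literature.MathematicalPhysics.QuantumFieldTheory.Balaban1983to89.T4Continuum
open Literature.MathematicalPhysics.QuantumFieldTheory.Balaban1983to89.T4AvgSensitivity
open Literature.MathematicalPhysics.QuantumFieldTheory.Balaban1983to89.T4AvgDerivBound
open B15.BasicStep T4DressedR T4DressingDefect T4FirstOrderSize T4CondLawRelative T4ObservableTelescope
open T4CondMeanChannel T4CondMeanChannelInsert T4CovarianceResponse T4SeparableFibreExpansion

variable {P : Params} {G : Type*} [GaugeGroup G] {k : ℕ} [DecidableEq (PBond P k)]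

omit [GaugeGroup G] in
/-- Dictionary: the fibre point `V₀ ← y` evaluated at a fibre bond. [folklore] -/
theorem updateFinset_apply_mem (V₀ : GaugeField P k G) (s : Finset (PBond P k)) (y : s → G) (b : s) :
    updateFinset V₀ s y (b : PBond P k) = y b := by
  simp [updateFinset, b.2]

omit [GaugeGroup G] in
/-- Dictionary: changing the fibre coordinate `b` does not change the configuration off `b`. [folklore] -/
theorem updateFinset_update_apply_ne (V₀ : GaugeField P k G) (s : Finset (PBond P k)) (y₀ : s → G) (b : s) (g : G)
    {c : PBond P k} (hc : c ≠ b) : updateFinset V₀ s (Function.update y₀ b g) c = updateFinset V₀ s y₀ c := by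
  by_cases hcs : c ∈ s
  · have hne : (⟨c, hcs⟩ : s) ≠ b := fun h' => hc (congrArg Subtype.val h')
    simp [updateFinset, hcs, Function.update_of_ne hne]
  · simp [updateFinset, hcs]

/-- **THE SHAPE ALONG A FIBRE**: for the loop weight `g = W_{(x,w)} ∘ avgⁿ` and the reflection triple of fibre points
`(y₀; b ← y_b)`, `y₀`, `(y₀; b ← y₀_b·y_b⁻¹·y₀_b)` through the exterior `V₀` — all three in the domain — the symmetric second
difference is at most `C₃|w|·bdist(y₀ b, y b)²·θ₃ⁿ`: LITERALLY the hypothesis `hdiag` of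
`T4SeparableFibreExpansion.abs_evenIncr_le_of_secondDiff`. [folklore] -/
theorem abs_secondDiff_loop_le {av : ∀ j, Averaging P j G} {dom : ∀ j, Set (GaugeField P j G)} {C₃ θ₃ : ℝ}
    (hdiag : LoopDiagDerivBound av dom C₃ θ₃) {n : ℕ} (hn : k + n ≤ P.m + P.K) {x : Site P (k + n)}
    {w : List (Letter P.d)} (hw : walkEnd x w = x) (s : Finset (PBond P k)) {V₀ : GaugeField P k G}
    {y₀ y : s → G} (b : s) (h₀ : updateFinset V₀ s y₀ ∈ dom k)
    (hₚ : updateFinset V₀ s (Function.update y₀ b (y b)) ∈ dom k)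
    (hₘ : updateFinset V₀ s (Function.update y₀ b (y₀ b * (y b)⁻¹ * y₀ b)) ∈ dom k) :
    |loopAt (iterFrom av k n (updateFinset V₀ s (Function.update y₀ b (y b)))) (walk x w)
        - 2 * loopAt (iterFrom av k n (updateFinset V₀ s y₀)) (walk x w)
        + loopAt (iterFrom av k n (updateFinset V₀ s (Function.update y₀ b (y₀ b * (y b)⁻¹ * y₀ b)))) (walk x w)|
      ≤ C₃ * (w.length : ℝ) * bdist (y₀ b) (y b) ^ 2 * θ₃ ^ n := by
  have e₀ := updateFinset_apply_mem V₀ s y₀ b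
  have eₚ : updateFinset V₀ s (Function.update y₀ b (y b)) (b : PBond P k) = y b := by
    rw [updateFinset_apply_mem, Function.update_self]
  have eₘ : updateFinset V₀ s (Function.update y₀ b (y₀ b * (y b)⁻¹ * y₀ b)) (b : PBond P k)
      = y₀ b * (y b)⁻¹ * y₀ b := by
    rw [updateFinset_apply_mem, Function.update_self]
  have h := hdiag k n hn x w hw b (updateFinset V₀ s y₀) (updateFinset V₀ s (Function.update y₀ b (y b)))
    (updateFinset V₀ s (Function.update y₀ b (y₀ b * (y b)⁻¹ * y₀ b))) h₀ hₚ hₘ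
    (fun c hc => updateFinset_update_apply_ne V₀ s y₀ b (y b) hc)
    (fun c hc => updateFinset_update_apply_ne V₀ s y₀ b _ hc) (by rw [eₘ, e₀, eₚ])
  simpa only [e₀, eₚ] using h

/-- **THE EVEN PART OF THE ONE-BOND INCREMENT of a loop weight** is at most `C₃|w|·bdist(y₀ b, y b)²·θ₃ⁿ / 2`
(`abs_evenIncr_le_of_secondDiff` with `abs_secondDiff_loop_le`): a `θ₃`-TYPE smallness × the SQUARE of the one-bond
distance to the reference — the diagonal self-energy made small at second order, which first-order data cannot do.
[folklore] -/
theorem abs_evenIncr_loop_le {av : ∀ j, Averaging P j G} {dom : ∀ j, Set (GaugeField P j G)} {C₃ θ₃ : ℝ}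
    (hdiag : LoopDiagDerivBound av dom C₃ θ₃) {n : ℕ} (hn : k + n ≤ P.m + P.K) {x : Site P (k + n)}
    {w : List (Letter P.d)} (hw : walkEnd x w = x) (s : Finset (PBond P k)) {V₀ : GaugeField P k G}
    {y₀ y : s → G} (b : s) (h₀ : updateFinset V₀ s y₀ ∈ dom k)
    (hₚ : updateFinset V₀ s (Function.update y₀ b (y b)) ∈ dom k)
    (hₘ : updateFinset V₀ s (Function.update y₀ b (y₀ b * (y b)⁻¹ * y₀ b)) ∈ dom k) :
    |evenIncr s (fun U => loopAt (iterFrom av k n U) (walk x w)) V₀ y₀ y b|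
      ≤ C₃ * (w.length : ℝ) * bdist (y₀ b) (y b) ^ 2 * θ₃ ^ n / 2 :=
  abs_evenIncr_le_of_secondDiff s _ V₀ y₀ y b (abs_secondDiff_loop_le hdiag hn hw s b h₀ hₚ hₘ)

variable [MeasurableSpace G] [HaarData G]

/-- **THE FLOOR `κ` OF THE INCREMENT READING'S SUPPRESSION DATUM, FOR A LOOP WEIGHT, IS `θ₃`-SMALL**: if every fibre point
over the exterior `V₀` lies in the regularity domain and the conditional law at `u` has one-bond second moment about the
reference `∫ bdist(y₀ b, y b)² d(condLaw s wt u) ≤ M u`, then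
`|E^{wt}[evenReading | u]_b| ≤ (C₃|w|θ₃ⁿ/2)·M u` — the hypothesis `heven` of
`T4SeparableFibreExpansion.condMeanSuppression_incrReading_of_split` with `κ u = (C₃|w|θ₃ⁿ/2)·M u`
(`abs_condMean_evenReading_le` with `D y = (C₃|w|θ₃ⁿ/2)·bdist(y₀ b, y b)²`). [folklore] -/
theorem abs_condMean_evenReading_loop_le {av : ∀ j, Averaging P j G} {dom : ∀ j, Set (GaugeField P j G)}
    {C₃ θ₃ : ℝ} (hdiag : LoopDiagDerivBound av dom C₃ θ₃) (hC₃ : 0 ≤ C₃) (hθ₃ : 0 ≤ θ₃) {n : ℕ}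
    (hn : k + n ≤ P.m + P.K) {x : Site P (k + n)} {w : List (Letter P.d)} (hw : walkEnd x w = x)
    (s : Finset (PBond P k)) {V₀ : GaugeField P k G} (y₀ : s → G) (hdom : ∀ y : s → G, updateFinset V₀ s y ∈ dom k)
    (wt : Density P k G) (u : GaugeField P k G) (b : s) {M : ℝ}
    (hInt : Integrable (fun y : s → G => bdist (y₀ b) (y b) ^ 2) (condLaw s wt u))
    (hM : ∫ y, bdist (y₀ b) (y b) ^ 2 ∂condLaw s wt u ≤ M) :
    |condMeanField s wt (evenReading s (fun U => loopAt (iterFrom av k n U) (walk x w)) V₀ y₀) u b|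
      ≤ C₃ * (w.length : ℝ) * θ₃ ^ n / 2 * M := by
  have hc : 0 ≤ C₃ * (w.length : ℝ) * θ₃ ^ n / 2 := by positivity
  have hD : ∀ y : s → G, |evenIncr s (fun U => loopAt (iterFrom av k n U) (walk x w)) V₀ y₀ y b|
      ≤ C₃ * (w.length : ℝ) * θ₃ ^ n / 2 * bdist (y₀ b) (y b) ^ 2 := fun y =>
    (abs_evenIncr_loop_le hdiag hn hw s b (hdom _) (hdom _) (hdom _)).trans_eq (by ring)
  refine (abs_condMean_evenReading_le s _ V₀ y₀ wt u b hD (hInt.const_mul _)).trans ?_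
  rw [integral_const_mul]
  exact mul_le_mul_of_nonneg_left hM hc

/-- … hence, uniformly over the fibre bonds: the `heven` binder of `condMeanSuppression_incrReading_of_split` on any set
`domU` of exteriors carrying a one-bond second-moment bound `M u` of the conditional laws. [folklore] -/
theorem heven_loop {av : ∀ j, Averaging P j G} {dom : ∀ j, Set (GaugeField P j G)} {C₃ θ₃ : ℝ}
    (hdiag : LoopDiagDerivBound av dom C₃ θ₃) (hC₃ : 0 ≤ C₃) (hθ₃ : 0 ≤ θ₃) {n : ℕ} (hn : k + n ≤ P.m + P.K)
    {x : Site P (k + n)} {w : List (Letter P.d)} (hw : walkEnd x w = x) (s : Finset (PBond P k))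
    {V₀ : GaugeField P k G} (y₀ : s → G) (hdom : ∀ y : s → G, updateFinset V₀ s y ∈ dom k) (wt : Density P k G)
    {domU : Set (GaugeField P k G)} {M : GaugeField P k G → ℝ}
    (hM : ∀ u ∈ domU, ∀ b : s, Integrable (fun y : s → G => bdist (y₀ b) (y b) ^ 2) (condLaw s wt u) ∧
      ∫ y, bdist (y₀ b) (y b) ^ 2 ∂condLaw s wt u ≤ M u) :
    ∀ u ∈ domU, ∀ b : s,
      |condMeanField s wt (evenReading s (fun U => loopAt (iterFrom av k n U) (walk x w)) V₀ y₀) u b|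
        ≤ C₃ * (w.length : ℝ) * θ₃ ^ n / 2 * M u :=
  fun u hu b => abs_condMean_evenReading_loop_le hdiag hC₃ hθ₃ hn hw s y₀ hdom wt u b (hM u hu b).1 (hM u hu b).2

/-- **THE INCREMENT READING'S SUPPRESSION DATUM FOR A LOOP WEIGHT, WITH A `θ₃`-SMALL FLOOR**: odd part suppressed
(`hodd`, e.g. `condMeanSuppression_oddReading_of_varianceBound` / `_of_weightSymm`), even part by `heven_loop` ⇒
`CondMeanSuppression domU (E^{wt}[incrReading | ·]) univ (fun u => lip·dev u + (C₃|w|θ₃ⁿ/2)·M u) 1`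
(`condMeanSuppression_incrReading_of_split`, by name). [folklore] -/
theorem condMeanSuppression_incrReading_loop [RegularGaugeGroup G] {av : ∀ j, Averaging P j G}
    (hav : ∀ j, Measurable (av j).avg) {dom : ∀ j, Set (GaugeField P j G)} {C₃ θ₃ : ℝ}
    (hdiag : LoopDiagDerivBound av dom C₃ θ₃) (hC₃ : 0 ≤ C₃) (hθ₃ : 0 ≤ θ₃) {n : ℕ} (hn : k + n ≤ P.m + P.K)
    {x : Site P (k + n)} {w : List (Letter P.d)} (hw : walkEnd x w = x) (s : Finset (PBond P k))
    (V₀ : GaugeField P k G) (y₀ : s → G) (hdom : ∀ y : s → G, updateFinset V₀ s y ∈ dom k) {wt : Density P k G}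
    {Cw : ℝ} (hCw : ∀ U, wt U ≤ Cw) {domU : Set (GaugeField P k G)} {dev M : GaugeField P k G → ℝ} {lip : ℝ}
    (hodd : CondMeanSuppression domU
      (condMeanField s wt (oddReading s (fun U => loopAt (iterFrom av k n U) (walk x w)) V₀ y₀)) Finset.univ dev lip)
    (hM : ∀ u ∈ domU, ∀ b : s, Integrable (fun y : s → G => bdist (y₀ b) (y b) ^ 2) (condLaw s wt u) ∧
      ∫ y, bdist (y₀ b) (y b) ^ 2 ∂condLaw s wt u ≤ M u) :
    CondMeanSuppression domU
      (condMeanField s wt (incrReading s (fun U => loopAt (iterFrom av k n U) (walk x w)) V₀ y₀)) Finset.univ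
      (fun u => lip * dev u + C₃ * (w.length : ℝ) * θ₃ ^ n / 2 * M u) 1 :=
  condMeanSuppression_incrReading_of_split s ((measurable_loopAt _).comp (measurable_iterFrom av hav k n))
    (fun _ => abs_loopAt_le_one _ _) V₀ y₀ hCw hodd (heven_loop hdiag hC₃ hθ₃ hn hw s y₀ hdom wt hM)

end Junction

/-! ## §3 The same for the channel's named weights `loopProdW av k n ws` (products of loop variables of the `n`-fold
average), from first-order AND diagonal second-order data, with the rate `Σᵢ C₃|wᵢ|θ₃ⁿ + (Σᵢ C₁|wᵢ|θ₁ⁿ)²` -/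

section Products

open _root_.MeasureTheory
open Function (updateFinset)
open Literature.MathematicalPhysics.QuantumFieldTheory.Balaban1983to89.T4Continuum
open Literature.MathematicalPhysics.QuantumFieldTheory.Balaban1983to89.T4AvgSensitivity
open Literature.MathematicalPhysics.QuantumFieldTheory.Balaban1983to89.T4AvgDerivBound
open B15.BasicStep T4DressedR T4DressingDefect T4FirstOrderSize T4CondLawRelative T4ObservableTelescope
open T4CondMeanChannel T4CondMeanChannelInsert T4CovarianceResponse T4SeparableFibreExpansion

variable {P : Params} {G : Type*} [GaugeGroup G] [MeasurableSpace G] [RegularGaugeGroup G] {k : ℕ}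
variable [DecidableEq (PBond P k)]

omit [GaugeGroup G] [MeasurableSpace G] [RegularGaugeGroup G] [DecidableEq (PBond P k)] in
/-- THE DIAGONAL RATE of a product of loop variables: `Σᵢ C₃|wᵢ|θ₃ⁿ + (Σᵢ C₁|wᵢ|θ₁ⁿ)²` (companion of
`T4SeparableFibreExpansion.loopProdRate`). [folklore] -/
def loopProdDiagRate {σ : Type*} {d : ℕ} (C₁ θ₁ C₃ θ₃ : ℝ) (n : ℕ) (ws : List (σ × List (Letter d))) : ℝ :=
  (ws.map fun xw => C₃ * (xw.2.length : ℝ) * θ₃ ^ n).sum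
    + (ws.map fun xw => C₁ * (xw.2.length : ℝ) * θ₁ ^ n).sum ^ 2

omit [GaugeGroup G] [MeasurableSpace G] [RegularGaugeGroup G] [DecidableEq (PBond P k)] in
/-- The diagonal rate is non-negative for non-negative constants. [folklore] -/
theorem loopProdDiagRate_nonneg {σ : Type*} {d : ℕ} {C₁ θ₁ C₃ θ₃ : ℝ} (hC₃ : 0 ≤ C₃) (hθ₃ : 0 ≤ θ₃) (n : ℕ)
    (ws : List (σ × List (Letter d))) : 0 ≤ loopProdDiagRate C₁ θ₁ C₃ θ₃ n ws := by
  refine add_nonneg (List.sum_nonneg ?_) (sq_nonneg _)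
  intro r hr
  obtain ⟨xw, _, rfl⟩ := List.mem_map.mp hr
  positivity

/-- **THE SYMMETRIC SECOND DIFFERENCE OF A PRODUCT OF LOOP VARIABLES along a fibre reflection triple** is at most
`loopProdDiagRate · bdist(y₀ b, y b)²`: each factor is bounded by one (`abs_loopAt_le_one`), its one-sided first
differences by `C₁|wᵢ|θ₁ⁿ·bdist` (`LoopDerivBound`, via `abs_bondIncr_loop_le`; the reflected side has the same size,
`bdist_bondReflect`), its diagonal second difference by `C₃|wᵢ|θ₃ⁿ·bdist²` (`LoopDiagDerivBound`), and `abs_diag_prod_le`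
assembles. [folklore] -/
theorem abs_secondDiff_loopProdW_le {av : ∀ j, Averaging P j G} {dom : ∀ j, Set (GaugeField P j G)}
    {C₁ θ₁ C₃ θ₃ : ℝ} (hder : LoopDerivBound av dom C₁ θ₁) (hdiag : LoopDiagDerivBound av dom C₃ θ₃) {n : ℕ}
    (hn : k + n ≤ P.m + P.K) (ws : List (Site P (k + n) × List (Letter P.d)))
    (hws : ∀ xw ∈ ws, walkEnd xw.1 xw.2 = xw.1) (s : Finset (PBond P k)) {V₀ : GaugeField P k G} {y₀ y : s → G}
    (b : s) (h₀ : updateFinset V₀ s y₀ ∈ dom k) (hₚ : updateFinset V₀ s (Function.update y₀ b (y b)) ∈ dom k)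
    (hₘ : updateFinset V₀ s (Function.update y₀ b (y₀ b * (y b)⁻¹ * y₀ b)) ∈ dom k) :
    |loopProdW av k n ws (updateFinset V₀ s (Function.update y₀ b (y b)))
        - 2 * loopProdW av k n ws (updateFinset V₀ s y₀)
        + loopProdW av k n ws (updateFinset V₀ s (Function.update y₀ b (y₀ b * (y b)⁻¹ * y₀ b)))|
      ≤ loopProdDiagRate C₁ θ₁ C₃ θ₃ n ws * bdist (y₀ b) (y b) ^ 2 := by
  set d : ℝ := bdist (y₀ b) (y b) with hd
  set Vₚ := updateFinset V₀ s (Function.update y₀ b (y b)) with hVₚ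
  set V := updateFinset V₀ s y₀ with hV
  set Vₘ := updateFinset V₀ s (Function.update y₀ b (y₀ b * (y b)⁻¹ * y₀ b)) with hVₘ
  have hrefl : Function.update y₀ b (bondReflect y₀ b y b) = Function.update y₀ b (y₀ b * (y b)⁻¹ * y₀ b) := by
    rw [bondReflect_apply_self]
  have key := abs_diag_prod_le
    (fun xw : Site P (k + n) × List (Letter P.d) => loopAt (iterFrom av k n Vₚ) (walk xw.1 xw.2))
    (fun xw => loopAt (iterFrom av k n V) (walk xw.1 xw.2))
    (fun xw => loopAt (iterFrom av k n Vₘ) (walk xw.1 xw.2))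
    (fun xw => C₁ * (xw.2.length : ℝ) * θ₁ ^ n * d) (fun xw => C₃ * (xw.2.length : ℝ) * θ₃ ^ n * d ^ 2) ws
    (fun xw hxw => by
      refine ⟨abs_loopAt_le_one _ _, abs_loopAt_le_one _ _, abs_loopAt_le_one _ _, ?_, ?_, ?_⟩
      · have h := abs_bondIncr_loop_le hder hn (hws xw hxw) s b h₀ hₚ (V₀ := V₀) (y := y) (y₀ := y₀)
        simp only [bondIncr] at h
        exact h.trans_eq (by rw [hd]; ring)
      · have h := abs_bondIncr_loop_le hder hn (hws xw hxw) s b h₀ (V₀ := V₀) (y := bondReflect y₀ b y) (y₀ := y₀)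
          (by rw [hrefl]; exact hₘ)
        simp only [bondIncr, bdist_bondReflect] at h
        rw [hrefl] at h
        exact h.trans_eq (by rw [hd]; ring)
      · exact (abs_secondDiff_loop_le hdiag hn (hws xw hxw) s b h₀ hₚ hₘ).trans_eq (by rw [hd]; ring))
  have e : (ws.map fun xw => C₃ * (xw.2.length : ℝ) * θ₃ ^ n * d ^ 2).sum
      + (ws.map fun xw => C₁ * (xw.2.length : ℝ) * θ₁ ^ n * d).sum ^ 2 = loopProdDiagRate C₁ θ₁ C₃ θ₃ n ws * d ^ 2 := by
    simp only [loopProdDiagRate, List.sum_map_mul_right]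
    ring
  simp only [loopProdW]
  exact key.trans_eq e

/-- **THE EVEN PART OF THE ONE-BOND INCREMENT OF `loopProdW`** is at most `loopProdDiagRate·bdist(y₀ b, y b)²/2`.
[folklore] -/
theorem abs_evenIncr_loopProdW_le {av : ∀ j, Averaging P j G} {dom : ∀ j, Set (GaugeField P j G)}
    {C₁ θ₁ C₃ θ₃ : ℝ} (hder : LoopDerivBound av dom C₁ θ₁) (hdiag : LoopDiagDerivBound av dom C₃ θ₃) {n : ℕ}
    (hn : k + n ≤ P.m + P.K) (ws : List (Site P (k + n) × List (Letter P.d)))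
    (hws : ∀ xw ∈ ws, walkEnd xw.1 xw.2 = xw.1) (s : Finset (PBond P k)) {V₀ : GaugeField P k G} {y₀ y : s → G}
    (b : s) (h₀ : updateFinset V₀ s y₀ ∈ dom k) (hₚ : updateFinset V₀ s (Function.update y₀ b (y b)) ∈ dom k)
    (hₘ : updateFinset V₀ s (Function.update y₀ b (y₀ b * (y b)⁻¹ * y₀ b)) ∈ dom k) :
    |evenIncr s (loopProdW av k n ws) V₀ y₀ y b| ≤ loopProdDiagRate C₁ θ₁ C₃ θ₃ n ws * bdist (y₀ b) (y b) ^ 2 / 2 :=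
  abs_evenIncr_le_of_secondDiff s _ V₀ y₀ y b (abs_secondDiff_loopProdW_le hder hdiag hn ws hws s b h₀ hₚ hₘ)

variable [HaarData G]

/-- **THE `heven` BINDER FOR `loopProdW`**: `|E^{wt}[evenReading | u]_b| ≤ (loopProdDiagRate/2)·M u` on any set of
exteriors with one-bond second-moment bound `M` of the conditional laws (all fibre points over `V₀` in the domain).
[folklore] -/
theorem heven_loopProdW {av : ∀ j, Averaging P j G} {dom : ∀ j, Set (GaugeField P j G)} {C₁ θ₁ C₃ θ₃ : ℝ}
    (hder : LoopDerivBound av dom C₁ θ₁) (hdiag : LoopDiagDerivBound av dom C₃ θ₃) (hC₃ : 0 ≤ C₃) (hθ₃ : 0 ≤ θ₃)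
    {n : ℕ} (hn : k + n ≤ P.m + P.K) (ws : List (Site P (k + n) × List (Letter P.d)))
    (hws : ∀ xw ∈ ws, walkEnd xw.1 xw.2 = xw.1) (s : Finset (PBond P k)) {V₀ : GaugeField P k G} (y₀ : s → G)
    (hdom : ∀ y : s → G, updateFinset V₀ s y ∈ dom k) (wt : Density P k G) {domU : Set (GaugeField P k G)}
    {M : GaugeField P k G → ℝ}
    (hM : ∀ u ∈ domU, ∀ b : s, Integrable (fun y : s → G => bdist (y₀ b) (y b) ^ 2) (condLaw s wt u) ∧
      ∫ y, bdist (y₀ b) (y b) ^ 2 ∂condLaw s wt u ≤ M u) :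
    ∀ u ∈ domU, ∀ b : s, |condMeanField s wt (evenReading s (loopProdW av k n ws) V₀ y₀) u b|
      ≤ loopProdDiagRate C₁ θ₁ C₃ θ₃ n ws / 2 * M u := by
  intro u hu b
  have hc : 0 ≤ loopProdDiagRate C₁ θ₁ C₃ θ₃ n ws / 2 :=
    div_nonneg (loopProdDiagRate_nonneg hC₃ hθ₃ n ws) zero_le_two
  have hD : ∀ y : s → G, |evenIncr s (loopProdW av k n ws) V₀ y₀ y b|
      ≤ loopProdDiagRate C₁ θ₁ C₃ θ₃ n ws / 2 * bdist (y₀ b) (y b) ^ 2 := fun y =>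
    (abs_evenIncr_loopProdW_le hder hdiag hn ws hws s b (hdom _) (hdom _) (hdom _)).trans_eq (by ring)
  refine (abs_condMean_evenReading_le s _ V₀ y₀ wt u b hD ((hM u hu b).1.const_mul _)).trans ?_
  rw [integral_const_mul]
  exact mul_le_mul_of_nonneg_left (hM u hu b).2 hc

/-- **THE INCREMENT READING'S SUPPRESSION DATUM FOR `loopProdW`, WITH A `θ`-SMALL FLOOR** — the law-side hypothesis
`hsupᵢ` of `T4SeparableFibreExpansion.condMeanGap_of_loopProd` with the diagonal explicit and small at second order:
`CondMeanSuppression domU (E^{wt}[incrReading | ·]) univ (fun u => lip·dev u + (loopProdDiagRate/2)·M u) 1`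
(`condMeanSuppression_incrReading_of_split` + `measurable_loopProdW` + `abs_loopProdW_le_one` + `heven_loopProdW`).
[folklore] -/
theorem condMeanSuppression_incrReading_loopProdW {av : ∀ j, Averaging P j G} (hav : ∀ j, Measurable (av j).avg)
    {dom : ∀ j, Set (GaugeField P j G)} {C₁ θ₁ C₃ θ₃ : ℝ} (hder : LoopDerivBound av dom C₁ θ₁)
    (hdiag : LoopDiagDerivBound av dom C₃ θ₃) (hC₃ : 0 ≤ C₃) (hθ₃ : 0 ≤ θ₃) {n : ℕ} (hn : k + n ≤ P.m + P.K)
    (ws : List (Site P (k + n) × List (Letter P.d))) (hws : ∀ xw ∈ ws, walkEnd xw.1 xw.2 = xw.1)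
    (s : Finset (PBond P k)) (V₀ : GaugeField P k G) (y₀ : s → G) (hdom : ∀ y : s → G, updateFinset V₀ s y ∈ dom k)
    {wt : Density P k G} {Cw : ℝ} (hCw : ∀ U, wt U ≤ Cw) {domU : Set (GaugeField P k G)}
    {dev M : GaugeField P k G → ℝ} {lip : ℝ}
    (hodd : CondMeanSuppression domU (condMeanField s wt (oddReading s (loopProdW av k n ws) V₀ y₀)) Finset.univ
      dev lip)
    (hM : ∀ u ∈ domU, ∀ b : s, Integrable (fun y : s → G => bdist (y₀ b) (y b) ^ 2) (condLaw s wt u) ∧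
      ∫ y, bdist (y₀ b) (y b) ^ 2 ∂condLaw s wt u ≤ M u) :
    CondMeanSuppression domU (condMeanField s wt (incrReading s (loopProdW av k n ws) V₀ y₀)) Finset.univ
      (fun u => lip * dev u + loopProdDiagRate C₁ θ₁ C₃ θ₃ n ws / 2 * M u) 1 :=
  condMeanSuppression_incrReading_of_split s (measurable_loopProdW av hav k n ws) (abs_loopProdW_le_one av k n ws)
    V₀ y₀ hCw hodd (heven_loopProdW hder hdiag hC₃ hθ₃ hn ws hws s y₀ hdom wt hM)

end Products

/-! ## §4 (v1.1) Rate arithmetic of the diagonal floor — closed geometric form, governing ratio `max θ₃ (θ₁²)`, decay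
and summability in the number `n` of averaging steps.  The shape's `θ₃` is a FREE parameter: §1–§3 hold for every
`0 ≤ θ₃`, and a summable floor needs only `θ₃ < 1` — in particular the generic FIRST-order expectation `θ₃ = θ₁` of the
second-order tower chain rule (kernel toy `T4JetTower`, t4-ne1p-p3 lineage, cited by name in the header, not imported)
is enough; the `θ₁²` of v1's heuristic is not needed anywhere. -/

section RateArithmetic

open Filter Topology
open Literature.MathematicalPhysics.QuantumFieldTheory.Balaban1983to89.T4Continuum

/-- THE TOTAL WORD LENGTH `Σᵢ |wᵢ|` of a list of based loops (a companion, on the generic list type used by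
`loopProdDiagRate` / `T4SeparableFibreExpansion.loopProdRate` / `T4AdaptedReference.loopIncrRate`, of
`T4UniformDefectJunction.wordLen`, which is stated for that module's `ULoop` lists). [folklore] -/
def totalWordLen {σ : Type*} {d : ℕ} (ws : List (σ × List (Letter d))) : ℝ :=
  (ws.map fun xw => (xw.2.length : ℝ)).sum

/-- [folklore] -/
@[simp] theorem totalWordLen_nil {σ : Type*} {d : ℕ} : totalWordLen ([] : List (σ × List (Letter d))) = 0 := by
  simp [totalWordLen]

/-- [folklore] -/
@[simp] theorem totalWordLen_cons {σ : Type*} {d : ℕ} (xw : σ × List (Letter d)) (ws : List (σ × List (Letter d))) :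
    totalWordLen (xw :: ws) = (xw.2.length : ℝ) + totalWordLen ws := by
  simp [totalWordLen]

/-- The total word length is non-negative. [folklore] -/
theorem totalWordLen_nonneg {σ : Type*} {d : ℕ} (ws : List (σ × List (Letter d))) : 0 ≤ totalWordLen ws := by
  refine List.sum_nonneg ?_
  intro r hr
  obtain ⟨xw, _, rfl⟩ := List.mem_map.mp hr
  positivity

/-- Linear sums over the loop list collapse to the total word length. [folklore] -/
theorem sum_map_mul_length_mul {σ : Type*} {d : ℕ} (c t : ℝ) (ws : List (σ × List (Letter d))) :
    (ws.map fun xw => c * (xw.2.length : ℝ) * t).sum = c * totalWordLen ws * t := by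
  induction ws with
  | nil => simp
  | cons xw ws ih => rw [List.map_cons, List.sum_cons, ih, totalWordLen_cons]; ring

/-- **CLOSED FORM OF THE DIAGONAL RATE**: `loopProdDiagRate C₁ θ₁ C₃ θ₃ n ws = C₃·ℓ·θ₃ⁿ + (C₁·ℓ)²·(θ₁²)ⁿ`,
`ℓ = totalWordLen ws` — two GEOMETRIC channels, with ratios `θ₃` (the shape's own rate) and `θ₁²` (the squared
first-order rate of the cross terms). [folklore] -/
theorem loopProdDiagRate_eq {σ : Type*} {d : ℕ} (C₁ θ₁ C₃ θ₃ : ℝ) (n : ℕ) (ws : List (σ × List (Letter d))) :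
    loopProdDiagRate C₁ θ₁ C₃ θ₃ n ws
      = C₃ * totalWordLen ws * θ₃ ^ n + (C₁ * totalWordLen ws) ^ 2 * (θ₁ ^ 2) ^ n := by
  simp only [loopProdDiagRate, sum_map_mul_length_mul]
  ring

/-- The diagonal rate is MONOTONE in the shape's rate parameter `θ₃` (non-negative constants). [folklore] -/
theorem loopProdDiagRate_mono_theta {σ : Type*} {d : ℕ} {C₁ θ₁ C₃ θ₃ θ₃' : ℝ} (hC₃ : 0 ≤ C₃) (hθ₃ : 0 ≤ θ₃)
    (h : θ₃ ≤ θ₃') (n : ℕ) (ws : List (σ × List (Letter d))) :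
    loopProdDiagRate C₁ θ₁ C₃ θ₃ n ws ≤ loopProdDiagRate C₁ θ₁ C₃ θ₃' n ws := by
  rw [loopProdDiagRate_eq, loopProdDiagRate_eq]
  have hℓ := totalWordLen_nonneg ws
  have hpow : θ₃ ^ n ≤ θ₃' ^ n := pow_le_pow_left₀ hθ₃ h n
  have hmain : C₃ * totalWordLen ws * θ₃ ^ n ≤ C₃ * totalWordLen ws * θ₃' ^ n :=
    mul_le_mul_of_nonneg_left hpow (mul_nonneg hC₃ hℓ)
  linarith

/-- **THE GOVERNING RATIO IS `max θ₃ (θ₁²)`**: `loopProdDiagRate C₁ θ₁ C₃ θ₃ n ws ≤ (C₃ℓ + (C₁ℓ)²)·(max θ₃ θ₁²)ⁿ`.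
[folklore] -/
theorem loopProdDiagRate_le_geom {σ : Type*} {d : ℕ} {C₁ θ₁ C₃ θ₃ : ℝ} (hC₃ : 0 ≤ C₃) (hθ₃ : 0 ≤ θ₃) (n : ℕ)
    (ws : List (σ × List (Letter d))) :
    loopProdDiagRate C₁ θ₁ C₃ θ₃ n ws
      ≤ (C₃ * totalWordLen ws + (C₁ * totalWordLen ws) ^ 2) * max θ₃ (θ₁ ^ 2) ^ n := by
  rw [loopProdDiagRate_eq]
  have hℓ := totalWordLen_nonneg ws
  have h3 : θ₃ ^ n ≤ max θ₃ (θ₁ ^ 2) ^ n := pow_le_pow_left₀ hθ₃ (le_max_left _ _) n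
  have h1 : (θ₁ ^ 2) ^ n ≤ max θ₃ (θ₁ ^ 2) ^ n := pow_le_pow_left₀ (sq_nonneg _) (le_max_right _ _) n
  have a3 : C₃ * totalWordLen ws * θ₃ ^ n ≤ C₃ * totalWordLen ws * max θ₃ (θ₁ ^ 2) ^ n :=
    mul_le_mul_of_nonneg_left h3 (mul_nonneg hC₃ hℓ)
  have a1 : (C₁ * totalWordLen ws) ^ 2 * (θ₁ ^ 2) ^ n ≤ (C₁ * totalWordLen ws) ^ 2 * max θ₃ (θ₁ ^ 2) ^ n :=
    mul_le_mul_of_nonneg_left h1 (sq_nonneg _)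
  linarith

/-- **DECAY IN THE NUMBER OF STEPS**: for `0 ≤ θ₁ < 1` and `0 ≤ θ₃ < 1` the diagonal rate tends to `0` — whatever the
value of `θ₃ < 1`. [folklore] -/
theorem tendsto_loopProdDiagRate {σ : Type*} {d : ℕ} {θ₁ θ₃ : ℝ} (hθ₁ : 0 ≤ θ₁) (hθ₁' : θ₁ < 1) (hθ₃ : 0 ≤ θ₃)
    (hθ₃' : θ₃ < 1) (C₁ C₃ : ℝ) (ws : List (σ × List (Letter d))) :
    Tendsto (fun n => loopProdDiagRate C₁ θ₁ C₃ θ₃ n ws) atTop (𝓝 0) := by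
  have hsq : θ₁ ^ 2 < 1 := pow_lt_one₀ hθ₁ hθ₁' two_ne_zero
  have h3 : Tendsto (fun n => C₃ * totalWordLen ws * θ₃ ^ n) atTop (𝓝 0) := by
    simpa using (tendsto_pow_atTop_nhds_zero_of_lt_one hθ₃ hθ₃').const_mul (C₃ * totalWordLen ws)
  have h1 : Tendsto (fun n => (C₁ * totalWordLen ws) ^ 2 * (θ₁ ^ 2) ^ n) atTop (𝓝 0) := by
    simpa using (tendsto_pow_atTop_nhds_zero_of_lt_one (sq_nonneg θ₁) hsq).const_mul ((C₁ * totalWordLen ws) ^ 2)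
  have h := h3.add h1
  rw [add_zero] at h
  simpa only [loopProdDiagRate_eq] using h

/-- **SUMMABILITY OVER THE NUMBER OF STEPS** (two geometric series): for `0 ≤ θ₁ < 1`, `0 ≤ θ₃ < 1` the diagonal rate is
summable in `n`. [folklore] -/
theorem summable_loopProdDiagRate {σ : Type*} {d : ℕ} {θ₁ θ₃ : ℝ} (hθ₁ : 0 ≤ θ₁) (hθ₁' : θ₁ < 1) (hθ₃ : 0 ≤ θ₃)
    (hθ₃' : θ₃ < 1) (C₁ C₃ : ℝ) (ws : List (σ × List (Letter d))) :
    Summable (fun n => loopProdDiagRate C₁ θ₁ C₃ θ₃ n ws) := by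
  have hsq : θ₁ ^ 2 < 1 := pow_lt_one₀ hθ₁ hθ₁' two_ne_zero
  have h3 : Summable (fun n => C₃ * totalWordLen ws * θ₃ ^ n) :=
    (summable_geometric_of_lt_one hθ₃ hθ₃').mul_left _
  have h1 : Summable (fun n => (C₁ * totalWordLen ws) ^ 2 * (θ₁ ^ 2) ^ n) :=
    (summable_geometric_of_lt_one (sq_nonneg θ₁) hsq).mul_left _
  simpa only [loopProdDiagRate_eq] using h3.add h1

/-- **THE SUM OVER THE NUMBER OF STEPS**: `Σₙ loopProdDiagRate C₁ θ₁ C₃ θ₃ n ws = C₃ℓ/(1 − θ₃) + (C₁ℓ)²/(1 − θ₁²)`.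
[folklore] -/
theorem tsum_loopProdDiagRate {σ : Type*} {d : ℕ} {θ₁ θ₃ : ℝ} (hθ₁ : 0 ≤ θ₁) (hθ₁' : θ₁ < 1) (hθ₃ : 0 ≤ θ₃)
    (hθ₃' : θ₃ < 1) (C₁ C₃ : ℝ) (ws : List (σ × List (Letter d))) :
    ∑' n, loopProdDiagRate C₁ θ₁ C₃ θ₃ n ws
      = C₃ * totalWordLen ws / (1 - θ₃) + (C₁ * totalWordLen ws) ^ 2 / (1 - θ₁ ^ 2) := by
  have hsq : θ₁ ^ 2 < 1 := pow_lt_one₀ hθ₁ hθ₁' two_ne_zero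
  have h3 : Summable (fun n => C₃ * totalWordLen ws * θ₃ ^ n) :=
    (summable_geometric_of_lt_one hθ₃ hθ₃').mul_left _
  have h1 : Summable (fun n => (C₁ * totalWordLen ws) ^ 2 * (θ₁ ^ 2) ^ n) :=
    (summable_geometric_of_lt_one (sq_nonneg θ₁) hsq).mul_left _
  simp only [loopProdDiagRate_eq]
  rw [h3.tsum_add h1, tsum_mul_left, tsum_mul_left, tsum_geometric_of_lt_one hθ₃ hθ₃',
    tsum_geometric_of_lt_one (sq_nonneg θ₁) hsq]
  ring

/-- **THE FIRST-ORDER RATE SUFFICES.**  At the GENERIC expectation `θ₃ = θ₁ ≤ 1` of the second-order tower chain rule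
(the second derivative of `W ∘ T^[n]` at the reference is `W″(0)·(θ₁ⁿ)² + W′(0)·Sₙ` with
`T₂θ₁ⁿ ≤ Sₙ₊₁ ≤ T₂θ₁ⁿ/(1 − θ₁)`, `T₂` = the one-step curvature — kernel toy `T4JetTower.TowerMap.S_succ_lower` /
`S_succ_upper` / `hasDerivAt_obs_iterate` / `exists_sq_rate_lt_obs`, t4-ne1p-p3 lineage, `T4JetTower.lean` v1 p188559:
a statement about scalar tower maps, NOT about Bałaban's averagings; cited by name, not imported) the diagonal floor
decays at the FIRST-order rate, `loopProdDiagRate C₁ θ₁ C₃ θ₁ n ws ≤ (C₃ℓ + (C₁ℓ)²)·θ₁ⁿ`, and is summable in `n` for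
`θ₁ < 1` (`summable_loopProdDiagRate`). [folklore] -/
theorem loopProdDiagRate_le_firstOrder {σ : Type*} {d : ℕ} {C₁ θ₁ C₃ : ℝ} (hC₃ : 0 ≤ C₃) (hθ₁ : 0 ≤ θ₁)
    (hθ₁' : θ₁ ≤ 1) (n : ℕ) (ws : List (σ × List (Letter d))) :
    loopProdDiagRate C₁ θ₁ C₃ θ₁ n ws ≤ (C₃ * totalWordLen ws + (C₁ * totalWordLen ws) ^ 2) * θ₁ ^ n := by
  have hsq : θ₁ ^ 2 ≤ θ₁ := by nlinarith
  have hmax : max θ₁ (θ₁ ^ 2) = θ₁ := max_eq_left hsq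
  have h := loopProdDiagRate_le_geom (C₁ := C₁) (θ₁ := θ₁) hC₃ hθ₁ n ws
  rwa [hmax] at h

end RateArithmetic

end Literature.MathematicalPhysics.QuantumFieldTheory.Balaban1983to89.T4AvgDiagBound
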